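import Summits.Ventures.HodgeRepro2.T7SupportCompactDensePoint
import Summits.Ventures.HodgeRepro2.T7SupportDenseRegularProduct

/-!
# The archimedean half of `(b′)` for the TWO-vector `f`: an open non-empty locus at each place, and a regular point
of every dense subset of the product (support, seat p1)

The test function declared in L3-ARGUMENT §2g′ (v15) is, at each archimedean place, the two-vector coefficient
`f_v(g) = d · conj ⟪u_A, π⁰_v(g) u_B⟫` with `u_A` the `(T_A, μ_A)`-weight vector, `u_B = π⁰_v(h_v) u_A` the `(T_B, μ_B)`-weight
vector. Its bi-torus orbital integral at `γ` is `[characters match] · ⟪u_A, π⁰_v(γ h_v) u_A⟫`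
(`T7SupportWeightTorusOrbital.torus_orbital_conj_eq`, the `hB` of that row being satisfied by definition), a continuous
function of `γ` (`T7SupportWeightTorusContinuous`) with the value `‖u_A‖² ≠ 0` at the NON-regular point `γ = h_v⁻¹`.
This file packages the consequence the line consumes — with NO condition on the datum beyond `u_A ≠ 0`:

* `twoVectorOrbital τ ρA ρB x h a b γ` — the bi-torus orbital integral of the two-vector coefficient at `γ`
  (vectors `τ(h) x`, `x`; tori `ρ_A`, `h ρ_B h⁻¹`; characters `u^{−a}`, `conj v^b`); `twoVectorOrbital_eq` (it is
  `⟪x, τ(γ h) x⟫`), `twoVectorOrbital_inv` (`= ‖x‖²` at `γ = h⁻¹`), `continuous_twoVectorOrbital`; on a character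
  (`ι₁`) it is `χ(γ h) ‖x‖²`, never zero (`twoVectorOrbital_ne_zero_of_character`);
* `regularNonvanishing τ ρA ρB x h a b Z = {γ | γ ∉ Z ∧ twoVectorOrbital … γ ≠ 0}` for a closed non-regular locus `Z`
  with empty interior: OPEN (`isOpen_regularNonvanishing`) and NON-EMPTY (`nonempty_regularNonvanishing`) — the
  «open and non-empty» that weak approximation consumes (t7-crit-2 l. 15359, record (b)); hence every dense `S ⊆ G`
  meets it (`exists_mem_dense_regularNonvanishing`);
* THREE PLACES (`exists_mem_dense_regular_twoVectorOrbital_ne_zero₃`): every dense `S ⊆ G₁ × G₂ × G₃` contains a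
  `γ₀` regular at all three places with the PRODUCT of the three two-vector orbital integrals non-zero — abstract
  groups, abstract unitary strongly continuous representations, abstract closed nowhere-dense non-regular loci;
* PI FORM (`exists_mem_dense_forall_regular_twoVectorOrbital_ne_zero`, `exists_mem_dense_regular_prod_twoVectorOrbital_ne_zero`):
  the same for a finite family of places `v : ι` and a dense `S ⊆ ∏_v G_v` — the shape of Lemma WA′'s conclusion
  (`Dense (Γ : Set (∀ v, G v))`, Tier7/Line3/DensityTransfer `dense_of_approximations`, restricted to the archimedean
  places): a `γ₀ ∈ S` regular at every place with `∏_v ⟪x_v, τ_v(γ₀,v h_v) x_v⟫ ≠ 0`;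
* THE MODEL (`exists_mem_dense_regular_twoVectorOrbital_ne_zero₃_model`, `…_explicit`): `U(2) × SU(1,1) × SU(1,1)`
  with the non-regular loci `{κ_v = 1}` of rows 680 / 695, at `ι₁` any strongly continuous unitary `τ` and weight vector
  `x ≠ 0`, at `ι₂, ι₃` the Bergman models with `u_A = z^{n_j}` (`T7SupportDenseRegularPoint.torusOrbital`).

This is §2g′ (2)'s «`a_{γ₀} ≠ 0` at a regular rational `γ₀` is `∏_v ⟪u_A, π⁰_v(γ₀ h_v) u_A⟫ ≠ 0`, supplied by Lemma WA′ +
rows 680 / 681 / 695» as ONE kernel statement per shape, the per-place `hq_v` of the one-vector chapter (rows 696–714)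
gone. What stays in words: that the rational points with the finite-place conditions form a dense `S` (Lemma WA′ —
a PRINTED input) and the dictionary real place ↔ model at the three places.

Explicit model and abstract representations only; nothing about the adelic group, any period, or (N).
Blind lane: Mathlib + the HodgeRepro2 prefix only; no sorry; axioms ⊆ {propext, Classical.choice, Quot.sound}.
-/

namespace Summit.Ventures.HodgeRepro2.T7SupportTwoVectorArchimedean

open MeasureTheory Topology
open scoped InnerProductSpace
open T5HaarCircle T7SupportTwoTorusInvariant T7SupportWeightTorusOrbital T7SupportWeightTorusContinuous
  T7SupportDenseRegularProduct T7SupportCompactRegularPoint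

variable [MeasurableSpace Circle] [BorelSpace Circle]

/-! ### One place, abstractly -/

section OnePlace

variable {G : Type*} [Group G] [TopologicalSpace G] [ContinuousMul G] {V : Type*} [NormedAddCommGroup V]
  [InnerProductSpace ℂ V]

/-- **the two-vector bi-torus orbital integral at `γ`**: vectors `τ(h) x` (the `(h ρ_B h⁻¹, b)`-weight vector `u_B`)
and `x` (the `(ρ_A, a)`-weight vector `u_A`), characters `u^{−a}`, `conj v^b` -/
noncomputable def twoVectorOrbital (τ : G →* (V →ₗ[ℂ] V)) (ρA ρB : Circle →* G) (x : V) (h : G) (a b : ℤ)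
    (γ : G) : ℂ :=
  ∫ u : Circle, ∫ v : Circle,
    coeff τ (τ h x) x (ρA u * γ * (h * ρB v * h⁻¹)) * ((u : ℂ) ^ (-a) * (starRingEnd ℂ) ((v : ℂ) ^ b))
    ∂haarCircle ∂haarCircle

omit [TopologicalSpace G] [ContinuousMul G] in
/-- **the two-vector orbital integral is the diagonal coefficient at `γ h`**: `⟪x, τ(γ h) x⟫` -/
theorem twoVectorOrbital_eq {τ : G →* (V →ₗ[ℂ] V)} (hτ : IsUnitaryRep τ) {ρA ρB : Circle →* G} {a b : ℤ}
    {x : V} (hA : IsWeightVector τ ρA a x) (hB : IsWeightVector τ ρB b x) (h γ : G) :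
    twoVectorOrbital τ ρA ρB x h a b γ = coeff τ x x (γ * h) := by
  unfold twoVectorOrbital
  rw [torus_orbital_conj_eq hτ hA hB h γ (-a) b, if_pos (by ring), if_pos rfl, one_mul, one_mul]

omit [TopologicalSpace G] [ContinuousMul G] in
/-- at `γ = h⁻¹` the two-vector orbital integral is `⟪x, x⟫ = ‖x‖²` -/
theorem twoVectorOrbital_inv {τ : G →* (V →ₗ[ℂ] V)} (hτ : IsUnitaryRep τ) {ρA ρB : Circle →* G} {a b : ℤ}
    {x : V} (hA : IsWeightVector τ ρA a x) (hB : IsWeightVector τ ρB b x) (h : G) :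
    twoVectorOrbital τ ρA ρB x h a b h⁻¹ = ⟪x, x⟫_ℂ := by
  rw [twoVectorOrbital_eq hτ hA hB h h⁻¹, inv_mul_cancel]
  unfold coeff
  rw [map_one, Module.End.one_apply]

omit [TopologicalSpace G] [ContinuousMul G] in
/-- **`‖u_A‖² ≠ 0`**: the two-vector orbital integral does not vanish at `γ = h⁻¹` (a non-regular point) -/
theorem twoVectorOrbital_inv_ne_zero {τ : G →* (V →ₗ[ℂ] V)} (hτ : IsUnitaryRep τ) {ρA ρB : Circle →* G}
    {a b : ℤ} {x : V} (hA : IsWeightVector τ ρA a x) (hB : IsWeightVector τ ρB b x) (hx : x ≠ 0) (h : G) :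
    twoVectorOrbital τ ρA ρB x h a b h⁻¹ ≠ 0 := by
  rw [twoVectorOrbital_inv hτ hA hB h]
  exact inner_self_ne_zero.2 hx

omit [MeasurableSpace Circle] [BorelSpace Circle] [TopologicalSpace G] [ContinuousMul G] in
/-- on a `τ`-stable line (`τ(g) x = χ(g) • x`, `x ≠ 0`) the character has no zeros -/
theorem character_ne_zero {τ : G →* (V →ₗ[ℂ] V)} (hτ : IsUnitaryRep τ) {x : V} (hx : x ≠ 0) {χ : G → ℂ}
    (hχ : ∀ g, τ g x = χ g • x) (g : G) : χ g ≠ 0 := by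
  intro h0
  have h1 := hτ g x x
  rw [hχ g, h0, zero_smul, inner_zero_left] at h1
  exact inner_self_ne_zero.2 hx h1.symm

omit [TopologicalSpace G] [ContinuousMul G] in
/-- **at a place where the component is a character** (`ι₁` of the line, memo v16 §2g R5: `u_A = u_B = 1_τ` up to a
scalar) **the two-vector orbital integral is `χ(γ h) ‖x‖²`** for every `γ` -/
theorem twoVectorOrbital_eq_of_character {τ : G →* (V →ₗ[ℂ] V)} (hτ : IsUnitaryRep τ) {ρA ρB : Circle →* G}
    {a b : ℤ} {x : V} (hA : IsWeightVector τ ρA a x) (hB : IsWeightVector τ ρB b x) {χ : G → ℂ}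
    (hχ : ∀ g, τ g x = χ g • x) (h γ : G) :
    twoVectorOrbital τ ρA ρB x h a b γ = χ (γ * h) * ⟪x, x⟫_ℂ := by
  rw [twoVectorOrbital_eq hτ hA hB h γ]
  unfold coeff
  rw [hχ (γ * h), inner_smul_right]

omit [TopologicalSpace G] [ContinuousMul G] in
/-- **on a character the two-vector orbital integral never vanishes** — no regularity and no condition at such a place
(the non-regular locus `Z = ∅` may be taken in the composites below) -/
theorem twoVectorOrbital_ne_zero_of_character {τ : G →* (V →ₗ[ℂ] V)} (hτ : IsUnitaryRep τ) {ρA ρB : Circle →* G}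
    {a b : ℤ} {x : V} (hA : IsWeightVector τ ρA a x) (hB : IsWeightVector τ ρB b x) (hx : x ≠ 0) {χ : G → ℂ}
    (hχ : ∀ g, τ g x = χ g • x) (h γ : G) : twoVectorOrbital τ ρA ρB x h a b γ ≠ 0 := by
  rw [twoVectorOrbital_eq_of_character hτ hA hB hχ h γ]
  exact mul_ne_zero (character_ne_zero hτ hx hχ _) (inner_self_ne_zero.2 hx)

/-- **the two-vector orbital integral is continuous in `γ`** (strongly continuous `τ`) -/
theorem continuous_twoVectorOrbital {τ : G →* (V →ₗ[ℂ] V)} (hτ : IsUnitaryRep τ) (hc : IsStronglyContinuous τ)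
    {ρA ρB : Circle →* G} {a b : ℤ} {x : V} (hA : IsWeightVector τ ρA a x) (hB : IsWeightVector τ ρB b x)
    (h : G) : Continuous (twoVectorOrbital τ ρA ρB x h a b) :=
  continuous_torusOrbital_conj hτ hc hA hB h (-a) b

/-- the non-vanishing set of the two-vector orbital integral is open -/
theorem isOpen_twoVectorOrbital_ne_zero {τ : G →* (V →ₗ[ℂ] V)} (hτ : IsUnitaryRep τ)
    (hc : IsStronglyContinuous τ) {ρA ρB : Circle →* G} {a b : ℤ} {x : V} (hA : IsWeightVector τ ρA a x)
    (hB : IsWeightVector τ ρB b x) (h : G) : IsOpen {γ : G | twoVectorOrbital τ ρA ρB x h a b γ ≠ 0} :=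
  T7SupportDenseRegularPoint.isOpen_ne_zero (continuous_twoVectorOrbital hτ hc hA hB h)

/-- **the regular non-vanishing locus** of the two-vector orbital integral, relative to a non-regular locus `Z` -/
def regularNonvanishing (τ : G →* (V →ₗ[ℂ] V)) (ρA ρB : Circle →* G) (x : V) (h : G) (a b : ℤ) (Z : Set G) :
    Set G :=
  {γ | γ ∉ Z ∧ twoVectorOrbital τ ρA ρB x h a b γ ≠ 0}

/-- **the regular non-vanishing locus is open** when the non-regular locus is closed -/
theorem isOpen_regularNonvanishing {τ : G →* (V →ₗ[ℂ] V)} (hτ : IsUnitaryRep τ) (hc : IsStronglyContinuous τ)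
    {ρA ρB : Circle →* G} {a b : ℤ} {x : V} (hA : IsWeightVector τ ρA a x) (hB : IsWeightVector τ ρB b x)
    (h : G) {Z : Set G} (hZc : IsClosed Z) : IsOpen (regularNonvanishing τ ρA ρB x h a b Z) := by
  have e : regularNonvanishing τ ρA ρB x h a b Z = {γ : G | twoVectorOrbital τ ρA ρB x h a b γ ≠ 0} \ Z := by
    ext γ
    simp only [regularNonvanishing, Set.mem_setOf_eq, Set.mem_sdiff]
    exact and_comm
  rw [e]
  exact (isOpen_twoVectorOrbital_ne_zero hτ hc hA hB h).sdiff hZc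

/-- **the regular non-vanishing locus is non-empty** when the non-regular locus has empty interior and `x ≠ 0`:
the open set `{twoVectorOrbital ≠ 0}` contains `h⁻¹` and is not contained in `Z` -/
theorem nonempty_regularNonvanishing {τ : G →* (V →ₗ[ℂ] V)} (hτ : IsUnitaryRep τ) (hc : IsStronglyContinuous τ)
    {ρA ρB : Circle →* G} {a b : ℤ} {x : V} (hA : IsWeightVector τ ρA a x) (hB : IsWeightVector τ ρB b x)
    (hx : x ≠ 0) (h : G) {Z : Set G} (hZ : interior Z = ∅) :
    (regularNonvanishing τ ρA ρB x h a b Z).Nonempty := by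
  obtain ⟨γ, hγ, hγZ⟩ := T7SupportDenseRegularPoint.exists_mem_notMem_of_interior_eq_empty
    (isOpen_twoVectorOrbital_ne_zero hτ hc hA hB h) ⟨h⁻¹, twoVectorOrbital_inv_ne_zero hτ hA hB hx h⟩ hZ
  exact ⟨γ, hγZ, hγ⟩

/-- **every dense subset contains a regular point with non-zero two-vector orbital integral** -/
theorem exists_mem_dense_regularNonvanishing {τ : G →* (V →ₗ[ℂ] V)} (hτ : IsUnitaryRep τ)
    (hc : IsStronglyContinuous τ) {ρA ρB : Circle →* G} {a b : ℤ} {x : V} (hA : IsWeightVector τ ρA a x)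
    (hB : IsWeightVector τ ρB b x) (hx : x ≠ 0) (h : G) {Z : Set G} (hZc : IsClosed Z) (hZ : interior Z = ∅)
    {S : Set G} (hS : Dense S) :
    ∃ γ₀ ∈ S, γ₀ ∉ Z ∧ twoVectorOrbital τ ρA ρB x h a b γ₀ ≠ 0 := by
  obtain ⟨s, hsS, hs⟩ := hS.exists_mem_open (isOpen_regularNonvanishing hτ hc hA hB h hZc)
    (nonempty_regularNonvanishing hτ hc hA hB hx h hZ)
  exact ⟨s, hsS, hs⟩

end OnePlace

/-! ### Three places, abstractly -/

section ThreePlaces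

variable {G₁ : Type*} [Group G₁] [TopologicalSpace G₁] [ContinuousMul G₁] {V₁ : Type*} [NormedAddCommGroup V₁]
  [InnerProductSpace ℂ V₁]
  {G₂ : Type*} [Group G₂] [TopologicalSpace G₂] [ContinuousMul G₂] {V₂ : Type*} [NormedAddCommGroup V₂]
  [InnerProductSpace ℂ V₂]
  {G₃ : Type*} [Group G₃] [TopologicalSpace G₃] [ContinuousMul G₃] {V₃ : Type*} [NormedAddCommGroup V₃]
  [InnerProductSpace ℂ V₃]

/-- **a regular point of every dense subset of `G₁ × G₂ × G₃` where the PRODUCT of the three two-vector orbital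
integrals is non-zero** — no condition on the data beyond `x_j ≠ 0`; the non-regular loci `Z_j` closed with empty
interior -/
theorem exists_mem_dense_regular_twoVectorOrbital_ne_zero₃
    {τ₁ : G₁ →* (V₁ →ₗ[ℂ] V₁)} (hτ₁ : IsUnitaryRep τ₁) (hc₁ : IsStronglyContinuous τ₁) {ρA₁ ρB₁ : Circle →* G₁}
    {a₁ b₁ : ℤ} {x₁ : V₁} (hA₁ : IsWeightVector τ₁ ρA₁ a₁ x₁) (hB₁ : IsWeightVector τ₁ ρB₁ b₁ x₁) (hx₁ : x₁ ≠ 0)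
    (h₁ : G₁) {Z₁ : Set G₁} (hZc₁ : IsClosed Z₁) (hZ₁ : interior Z₁ = ∅)
    {τ₂ : G₂ →* (V₂ →ₗ[ℂ] V₂)} (hτ₂ : IsUnitaryRep τ₂) (hc₂ : IsStronglyContinuous τ₂) {ρA₂ ρB₂ : Circle →* G₂}
    {a₂ b₂ : ℤ} {x₂ : V₂} (hA₂ : IsWeightVector τ₂ ρA₂ a₂ x₂) (hB₂ : IsWeightVector τ₂ ρB₂ b₂ x₂) (hx₂ : x₂ ≠ 0)
    (h₂ : G₂) {Z₂ : Set G₂} (hZc₂ : IsClosed Z₂) (hZ₂ : interior Z₂ = ∅)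
    {τ₃ : G₃ →* (V₃ →ₗ[ℂ] V₃)} (hτ₃ : IsUnitaryRep τ₃) (hc₃ : IsStronglyContinuous τ₃) {ρA₃ ρB₃ : Circle →* G₃}
    {a₃ b₃ : ℤ} {x₃ : V₃} (hA₃ : IsWeightVector τ₃ ρA₃ a₃ x₃) (hB₃ : IsWeightVector τ₃ ρB₃ b₃ x₃) (hx₃ : x₃ ≠ 0)
    (h₃ : G₃) {Z₃ : Set G₃} (hZc₃ : IsClosed Z₃) (hZ₃ : interior Z₃ = ∅)
    {S : Set (G₁ × G₂ × G₃)} (hS : Dense S) :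
    ∃ γ₀ ∈ S,
      twoVectorOrbital τ₁ ρA₁ ρB₁ x₁ h₁ a₁ b₁ γ₀.1 * twoVectorOrbital τ₂ ρA₂ ρB₂ x₂ h₂ a₂ b₂ γ₀.2.1 *
        twoVectorOrbital τ₃ ρA₃ ρB₃ x₃ h₃ a₃ b₃ γ₀.2.2 ≠ 0 ∧
      γ₀.1 ∉ Z₁ ∧ γ₀.2.1 ∉ Z₂ ∧ γ₀.2.2 ∉ Z₃ := by
  obtain ⟨s, hsS, h1, h2, h3, hZ1, hZ2, hZ3⟩ := exists_mem_dense_prod₃_ne_zero_notMem hS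
    (continuous_twoVectorOrbital hτ₁ hc₁ hA₁ hB₁ h₁) (continuous_twoVectorOrbital hτ₂ hc₂ hA₂ hB₂ h₂)
    (continuous_twoVectorOrbital hτ₃ hc₃ hA₃ hB₃ h₃)
    ⟨h₁⁻¹, twoVectorOrbital_inv_ne_zero hτ₁ hA₁ hB₁ hx₁ h₁⟩ ⟨h₂⁻¹, twoVectorOrbital_inv_ne_zero hτ₂ hA₂ hB₂ hx₂ h₂⟩
    ⟨h₃⁻¹, twoVectorOrbital_inv_ne_zero hτ₃ hA₃ hB₃ hx₃ h₃⟩ hZc₁ hZ₁ hZc₂ hZ₂ hZc₃ hZ₃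
  exact ⟨s, hsS, mul_ne_zero (mul_ne_zero h1 h2) h3, hZ1, hZ2, hZ3⟩

/-- the same with the three orbital integrals written as the diagonal coefficients at `γ₀ h_j`:
`∏_j ⟪x_j, τ_j(γ₀,j h_j) x_j⟫ ≠ 0` -/
theorem exists_mem_dense_regular_coeff_ne_zero₃
    {τ₁ : G₁ →* (V₁ →ₗ[ℂ] V₁)} (hτ₁ : IsUnitaryRep τ₁) (hc₁ : IsStronglyContinuous τ₁) {ρA₁ ρB₁ : Circle →* G₁}
    {a₁ b₁ : ℤ} {x₁ : V₁} (hA₁ : IsWeightVector τ₁ ρA₁ a₁ x₁) (hB₁ : IsWeightVector τ₁ ρB₁ b₁ x₁) (hx₁ : x₁ ≠ 0)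
    (h₁ : G₁) {Z₁ : Set G₁} (hZc₁ : IsClosed Z₁) (hZ₁ : interior Z₁ = ∅)
    {τ₂ : G₂ →* (V₂ →ₗ[ℂ] V₂)} (hτ₂ : IsUnitaryRep τ₂) (hc₂ : IsStronglyContinuous τ₂) {ρA₂ ρB₂ : Circle →* G₂}
    {a₂ b₂ : ℤ} {x₂ : V₂} (hA₂ : IsWeightVector τ₂ ρA₂ a₂ x₂) (hB₂ : IsWeightVector τ₂ ρB₂ b₂ x₂) (hx₂ : x₂ ≠ 0)
    (h₂ : G₂) {Z₂ : Set G₂} (hZc₂ : IsClosed Z₂) (hZ₂ : interior Z₂ = ∅)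
    {τ₃ : G₃ →* (V₃ →ₗ[ℂ] V₃)} (hτ₃ : IsUnitaryRep τ₃) (hc₃ : IsStronglyContinuous τ₃) {ρA₃ ρB₃ : Circle →* G₃}
    {a₃ b₃ : ℤ} {x₃ : V₃} (hA₃ : IsWeightVector τ₃ ρA₃ a₃ x₃) (hB₃ : IsWeightVector τ₃ ρB₃ b₃ x₃) (hx₃ : x₃ ≠ 0)
    (h₃ : G₃) {Z₃ : Set G₃} (hZc₃ : IsClosed Z₃) (hZ₃ : interior Z₃ = ∅)
    {S : Set (G₁ × G₂ × G₃)} (hS : Dense S) :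
    ∃ γ₀ ∈ S,
      coeff τ₁ x₁ x₁ (γ₀.1 * h₁) * coeff τ₂ x₂ x₂ (γ₀.2.1 * h₂) * coeff τ₃ x₃ x₃ (γ₀.2.2 * h₃) ≠ 0 ∧
      γ₀.1 ∉ Z₁ ∧ γ₀.2.1 ∉ Z₂ ∧ γ₀.2.2 ∉ Z₃ := by
  obtain ⟨γ₀, hγS, hne, hZ1, hZ2, hZ3⟩ := exists_mem_dense_regular_twoVectorOrbital_ne_zero₃ hτ₁ hc₁ hA₁ hB₁ hx₁ h₁
    hZc₁ hZ₁ hτ₂ hc₂ hA₂ hB₂ hx₂ h₂ hZc₂ hZ₂ hτ₃ hc₃ hA₃ hB₃ hx₃ h₃ hZc₃ hZ₃ hS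
  refine ⟨γ₀, hγS, ?_, hZ1, hZ2, hZ3⟩
  rwa [twoVectorOrbital_eq hτ₁ hA₁ hB₁ h₁, twoVectorOrbital_eq hτ₂ hA₂ hB₂ h₂, twoVectorOrbital_eq hτ₃ hA₃ hB₃ h₃]
    at hne

end ThreePlaces

/-! ### Finitely many places in Pi form — the shape of Lemma WA′'s conclusion (`Dense (Γ : Set (∀ v, G v))`) -/

section PiPlaces

variable {ι : Type*} [Fintype ι] {G : ι → Type*} [∀ v, Group (G v)] [∀ v, TopologicalSpace (G v)]
  [∀ v, ContinuousMul (G v)] {V : ι → Type*} [∀ v, NormedAddCommGroup (V v)] [∀ v, InnerProductSpace ℂ (V v)]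

/-- the product over the places of the regular non-vanishing loci is open -/
theorem isOpen_pi_regularNonvanishing {τ : ∀ v, G v →* (V v →ₗ[ℂ] V v)} (hτ : ∀ v, IsUnitaryRep (τ v))
    (hc : ∀ v, IsStronglyContinuous (τ v)) {ρA ρB : ∀ v, Circle →* G v} {a b : ι → ℤ} {x : ∀ v, V v}
    (hA : ∀ v, IsWeightVector (τ v) (ρA v) (a v) (x v)) (hB : ∀ v, IsWeightVector (τ v) (ρB v) (b v) (x v))
    (h : ∀ v, G v) {Z : ∀ v, Set (G v)} (hZc : ∀ v, IsClosed (Z v)) :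
    IsOpen (Set.pi Set.univ fun v => regularNonvanishing (τ v) (ρA v) (ρB v) (x v) (h v) (a v) (b v) (Z v)) :=
  isOpen_set_pi Set.finite_univ fun v _ => isOpen_regularNonvanishing (hτ v) (hc v) (hA v) (hB v) (h v) (hZc v)

omit [Fintype ι] in
/-- the product over the places of the regular non-vanishing loci is non-empty -/
theorem nonempty_pi_regularNonvanishing {τ : ∀ v, G v →* (V v →ₗ[ℂ] V v)} (hτ : ∀ v, IsUnitaryRep (τ v))
    (hc : ∀ v, IsStronglyContinuous (τ v)) {ρA ρB : ∀ v, Circle →* G v} {a b : ι → ℤ} {x : ∀ v, V v}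
    (hA : ∀ v, IsWeightVector (τ v) (ρA v) (a v) (x v)) (hB : ∀ v, IsWeightVector (τ v) (ρB v) (b v) (x v))
    (hx : ∀ v, x v ≠ 0) (h : ∀ v, G v) {Z : ∀ v, Set (G v)} (hZ : ∀ v, interior (Z v) = ∅) :
    (Set.pi Set.univ fun v => regularNonvanishing (τ v) (ρA v) (ρB v) (x v) (h v) (a v) (b v) (Z v)).Nonempty :=
  Set.univ_pi_nonempty_iff.2 fun v => nonempty_regularNonvanishing (hτ v) (hc v) (hA v) (hB v) (hx v) (h v) (hZ v)

/-- **a regular point of every dense subset of `∏_v G_v` with every two-vector orbital integral non-zero** — the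
shape that composes with Lemma WA′ (`Dense (Γ : Set (∀ v, G v))`, restricted to the archimedean places) -/
theorem exists_mem_dense_forall_regular_twoVectorOrbital_ne_zero {τ : ∀ v, G v →* (V v →ₗ[ℂ] V v)}
    (hτ : ∀ v, IsUnitaryRep (τ v)) (hc : ∀ v, IsStronglyContinuous (τ v)) {ρA ρB : ∀ v, Circle →* G v}
    {a b : ι → ℤ} {x : ∀ v, V v} (hA : ∀ v, IsWeightVector (τ v) (ρA v) (a v) (x v))
    (hB : ∀ v, IsWeightVector (τ v) (ρB v) (b v) (x v)) (hx : ∀ v, x v ≠ 0) (h : ∀ v, G v) {Z : ∀ v, Set (G v)}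
    (hZc : ∀ v, IsClosed (Z v)) (hZ : ∀ v, interior (Z v) = ∅) {S : Set (∀ v, G v)} (hS : Dense S) :
    ∃ γ₀ ∈ S, ∀ v, γ₀ v ∉ Z v ∧ twoVectorOrbital (τ v) (ρA v) (ρB v) (x v) (h v) (a v) (b v) (γ₀ v) ≠ 0 := by
  obtain ⟨γ₀, hγS, hγ⟩ := hS.exists_mem_open (isOpen_pi_regularNonvanishing hτ hc hA hB h hZc)
    (nonempty_pi_regularNonvanishing hτ hc hA hB hx h hZ)
  exact ⟨γ₀, hγS, fun v => Set.mem_univ_pi.1 hγ v⟩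

/-- the same with the conclusion as a PRODUCT over the places: `∏_v ⟪x_v, τ_v(γ₀,v h_v) x_v⟫ ≠ 0` at a `γ₀ ∈ S` regular at
every place -/
theorem exists_mem_dense_regular_prod_twoVectorOrbital_ne_zero {τ : ∀ v, G v →* (V v →ₗ[ℂ] V v)}
    (hτ : ∀ v, IsUnitaryRep (τ v)) (hc : ∀ v, IsStronglyContinuous (τ v)) {ρA ρB : ∀ v, Circle →* G v}
    {a b : ι → ℤ} {x : ∀ v, V v} (hA : ∀ v, IsWeightVector (τ v) (ρA v) (a v) (x v))
    (hB : ∀ v, IsWeightVector (τ v) (ρB v) (b v) (x v)) (hx : ∀ v, x v ≠ 0) (h : ∀ v, G v) {Z : ∀ v, Set (G v)}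
    (hZc : ∀ v, IsClosed (Z v)) (hZ : ∀ v, interior (Z v) = ∅) {S : Set (∀ v, G v)} (hS : Dense S) :
    ∃ γ₀ ∈ S, (∀ v, γ₀ v ∉ Z v) ∧
      ∏ v, coeff (τ v) (x v) (x v) (γ₀ v * h v) ≠ 0 := by
  obtain ⟨γ₀, hγS, hγ⟩ := exists_mem_dense_forall_regular_twoVectorOrbital_ne_zero hτ hc hA hB hx h hZc hZ hS
  refine ⟨γ₀, hγS, fun v => (hγ v).1, Finset.prod_ne_zero_iff.2 fun v _ => ?_⟩
  rw [← twoVectorOrbital_eq (hτ v) (hA v) (hB v) (h v) (γ₀ v)]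
  exact (hγ v).2

end PiPlaces

/-! ### The model: `U(2) × SU(1,1) × SU(1,1)` with the non-regular loci `{κ_v = 1}` -/

section Model

open T5SU11Unimodular

variable {V₁ : Type*} [NormedAddCommGroup V₁] [InnerProductSpace ℂ V₁]

/-- **the model at all three places** — `ι₁`: `U(2)`, any strongly continuous unitary `τ`, a weight vector `x ≠ 0` of
both tori; `ι₂, ι₃`: the weight-`k_j` Bergman models of `SU(1,1)` with `u_A = z^{n_j}` (row 680's `torusOrbital`);
every dense `S` contains a `γ₀` REGULAR at all three places (`κ_v(γ₀) ≠ 1`, rows 680 / 695) with the product of the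
three two-vector orbital integrals non-zero -/
theorem exists_mem_dense_regular_twoVectorOrbital_ne_zero₃_model {τ : U2 →* (V₁ →ₗ[ℂ] V₁)} (hτ : IsUnitaryRep τ)
    (hc : IsStronglyContinuous τ) {ρA ρB : Circle →* U2} {a b : ℤ} {x : V₁} (hA : IsWeightVector τ ρA a x)
    (hB : IsWeightVector τ ρB b x) (hx : x ≠ 0) (h₁ : U2)
    (k₂ n₂ : ℕ) (hk₂ : 2 ≤ k₂) (h₂ : SU11) (k₃ n₃ : ℕ) (hk₃ : 2 ≤ k₃) (h₃ : SU11)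
    {S : Set (U2 × SU11 × SU11)} (hS : Dense S) :
    ∃ γ₀ ∈ S,
      twoVectorOrbital τ ρA ρB x h₁ a b γ₀.1 * T7SupportDenseRegularPoint.torusOrbital k₂ n₂ h₂ γ₀.2.1 *
        T7SupportDenseRegularPoint.torusOrbital k₃ n₃ h₃ γ₀.2.2 ≠ 0 ∧
      kappa (starRingEnd ℂ) dd2 (colBasis h₁) (matU γ₀.1) ≠ 1 ∧
      kappa (starRingEnd ℂ) T7SupportKappaCartan.dd (T7SupportKappaCartan.colBasis h₂) (T5BergmanCoefficient.mat γ₀.2.1) ≠ 1 ∧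
      kappa (starRingEnd ℂ) T7SupportKappaCartan.dd (T7SupportKappaCartan.colBasis h₃) (T5BergmanCoefficient.mat γ₀.2.2) ≠ 1 := by
  obtain ⟨s, hsS, h1, h2, h3, hZ1, hZ2, hZ3⟩ := exists_mem_dense_prod₃_ne_zero_notMem hS
    (continuous_twoVectorOrbital hτ hc hA hB h₁) (T7SupportDenseRegularPoint.continuous_torusOrbital k₂ n₂ hk₂ h₂)
    (T7SupportDenseRegularPoint.continuous_torusOrbital k₃ n₃ hk₃ h₃)
    ⟨h₁⁻¹, twoVectorOrbital_inv_ne_zero hτ hA hB hx h₁⟩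
    (let ⟨γ, _, hγ⟩ := T7SupportDenseRegularPoint.nonempty_regularNonvanishing k₂ n₂ hk₂ h₂; ⟨γ, hγ⟩)
    (let ⟨γ, _, hγ⟩ := T7SupportDenseRegularPoint.nonempty_regularNonvanishing k₃ n₃ hk₃ h₃; ⟨γ, hγ⟩)
    (T7SupportCompactDensePoint.isClosed_kappa_eq_one h₁) (T7SupportCompactDensePoint.interior_kappa_eq_one_eq_empty h₁)
    (T7SupportDenseRegularPoint.isClosed_kappa_eq_one h₂) (T7SupportDenseRegularPoint.interior_kappa_eq_one_eq_empty h₂)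
    (T7SupportDenseRegularPoint.isClosed_kappa_eq_one h₃) (T7SupportDenseRegularPoint.interior_kappa_eq_one_eq_empty h₃)
  exact ⟨s, hsS, mul_ne_zero (mul_ne_zero h1 h2) h3, hZ1, hZ2, hZ3⟩

/-- the same with every orbital integral written out: at `ι₁` the bi-torus integral of `⟪x, τ(·) τ(h₁) x⟫` against
`u^{−a} conj v^b`, at `ι_j` the bi-torus integral of `⟨π_{k_j}(·) π_{k_j}(h_j) z^{n_j}, z^{n_j}⟩_{k_j}` against
`u^{k_j+2n_j} conj v^{−(k_j+2n_j)}` -/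
theorem exists_mem_dense_regular_twoVectorOrbital_ne_zero₃_explicit {τ : U2 →* (V₁ →ₗ[ℂ] V₁)}
    (hτ : IsUnitaryRep τ) (hc : IsStronglyContinuous τ) {ρA ρB : Circle →* U2} {a b : ℤ} {x : V₁}
    (hA : IsWeightVector τ ρA a x) (hB : IsWeightVector τ ρB b x) (hx : x ≠ 0) (h₁ : U2)
    (k₂ n₂ : ℕ) (hk₂ : 2 ≤ k₂) (h₂ : SU11) (k₃ n₃ : ℕ) (hk₃ : 2 ≤ k₃) (h₃ : SU11)
    {S : Set (U2 × SU11 × SU11)} (hS : Dense S) :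
    ∃ γ₀ ∈ S,
      (∫ u : Circle, ∫ v : Circle, coeff τ (τ h₁ x) x (ρA u * γ₀.1 * (h₁ * ρB v * h₁⁻¹)) *
          ((u : ℂ) ^ (-a) * (starRingEnd ℂ) ((v : ℂ) ^ b)) ∂haarCircle ∂haarCircle) *
        (∫ u : Circle, ∫ v : Circle,
          T5BergmanMatrixCoeff.matrixCoeff k₂ (T5BergmanCoefficient.act k₂ h₂ (fun w => w ^ n₂)) (fun w => w ^ n₂)
            (T5SU11Fibration.rot u * γ₀.2.1 * (h₂ * T5SU11Fibration.rot v * h₂⁻¹)) *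
            ((u : ℂ) ^ ((k₂ + 2 * n₂ : ℕ) : ℤ) * (starRingEnd ℂ) ((v : ℂ) ^ (-(k₂ + 2 * n₂ : ℕ) : ℤ)))
            ∂haarCircle ∂haarCircle) *
        (∫ u : Circle, ∫ v : Circle,
          T5BergmanMatrixCoeff.matrixCoeff k₃ (T5BergmanCoefficient.act k₃ h₃ (fun w => w ^ n₃)) (fun w => w ^ n₃)
            (T5SU11Fibration.rot u * γ₀.2.2 * (h₃ * T5SU11Fibration.rot v * h₃⁻¹)) *
            ((u : ℂ) ^ ((k₃ + 2 * n₃ : ℕ) : ℤ) * (starRingEnd ℂ) ((v : ℂ) ^ (-(k₃ + 2 * n₃ : ℕ) : ℤ)))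
            ∂haarCircle ∂haarCircle) ≠ 0 ∧
      kappa (starRingEnd ℂ) dd2 (colBasis h₁) (matU γ₀.1) ≠ 1 ∧
      kappa (starRingEnd ℂ) T7SupportKappaCartan.dd (T7SupportKappaCartan.colBasis h₂) (T5BergmanCoefficient.mat γ₀.2.1) ≠ 1 ∧
      kappa (starRingEnd ℂ) T7SupportKappaCartan.dd (T7SupportKappaCartan.colBasis h₃) (T5BergmanCoefficient.mat γ₀.2.2) ≠ 1 :=
  exists_mem_dense_regular_twoVectorOrbital_ne_zero₃_model hτ hc hA hB hx h₁ k₂ n₂ hk₂ h₂ k₃ n₃ hk₃ h₃ hS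

/-- the model statement in coefficient form: `⟪x, τ(γ₀,1 h₁) x⟫ · ⟨π_{k₂}(γ₀,2 h₂) z^{n₂}, z^{n₂}⟩ · ⟨π_{k₃}(γ₀,3 h₃) z^{n₃}, z^{n₃}⟩ ≠ 0`
at a `γ₀ ∈ S` regular at the three places -/
theorem exists_mem_dense_regular_coeff_ne_zero₃_model {τ : U2 →* (V₁ →ₗ[ℂ] V₁)} (hτ : IsUnitaryRep τ)
    (hc : IsStronglyContinuous τ) {ρA ρB : Circle →* U2} {a b : ℤ} {x : V₁} (hA : IsWeightVector τ ρA a x)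
    (hB : IsWeightVector τ ρB b x) (hx : x ≠ 0) (h₁ : U2)
    (k₂ n₂ : ℕ) (hk₂ : 2 ≤ k₂) (h₂ : SU11) (k₃ n₃ : ℕ) (hk₃ : 2 ≤ k₃) (h₃ : SU11)
    {S : Set (U2 × SU11 × SU11)} (hS : Dense S) :
    ∃ γ₀ ∈ S,
      coeff τ x x (γ₀.1 * h₁) * T5BergmanMatrixCoeff.matrixCoeff k₂ (fun w => w ^ n₂) (fun w => w ^ n₂) (γ₀.2.1 * h₂) *
        T5BergmanMatrixCoeff.matrixCoeff k₃ (fun w => w ^ n₃) (fun w => w ^ n₃) (γ₀.2.2 * h₃) ≠ 0 ∧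
      kappa (starRingEnd ℂ) dd2 (colBasis h₁) (matU γ₀.1) ≠ 1 ∧
      kappa (starRingEnd ℂ) T7SupportKappaCartan.dd (T7SupportKappaCartan.colBasis h₂) (T5BergmanCoefficient.mat γ₀.2.1) ≠ 1 ∧
      kappa (starRingEnd ℂ) T7SupportKappaCartan.dd (T7SupportKappaCartan.colBasis h₃) (T5BergmanCoefficient.mat γ₀.2.2) ≠ 1 := by
  obtain ⟨γ₀, hγS, hne, hZ1, hZ2, hZ3⟩ := exists_mem_dense_regular_twoVectorOrbital_ne_zero₃_model hτ hc hA hB hx h₁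
    k₂ n₂ hk₂ h₂ k₃ n₃ hk₃ h₃ hS
  refine ⟨γ₀, hγS, ?_, hZ1, hZ2, hZ3⟩
  rwa [twoVectorOrbital_eq hτ hA hB h₁, T7SupportDenseRegularPoint.torusOrbital_eq k₂ n₂ hk₂ h₂,
    T7SupportDenseRegularPoint.torusOrbital_eq k₃ n₃ hk₃ h₃] at hne

end Model

end Summit.Ventures.HodgeRepro2.T7SupportTwoVectorArchimedean
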